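import Summits.NavierStokesRegularity.FluidComputer.DesignedBlowupSubLerayRate
import Summits.NavierStokesRegularity.FluidComputer.DesignedBlowupVelocityUnbounded
import Summits.NavierStokesRegularity.FluidComputer.ForcedContinuationRate
import Literature.Analysis.FluidPDE.TaoH1LocalExistenceForcedHolds
import HarnessLib

/-!
# The E–C compatibility list on `DesignedBlowup ν` — UNCONDITIONAL (F2 discharged)

Cell `ns-blowup`, seat `ns-blowup-ecbridge-2` (g5; the E–C endpoint theory seat). LABEL: E–C typing
(KERNEL — no named fact). WHAT THIS IS NOT: not Navier–Stokes evidence — necessary conditions on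
the TYPE `DesignedBlowup` (no inhabitant is claimed anywhere). Companion memo:
`run/shared/lean/pub/ns-blowup/ecbridge2/ECBRIDGE-2-MEMO-3.md` §2.

## Content

Every conditional row of the seat's compatibility list on the generic E–C object was, since g4,
modulo ONE named fact, F2 = `tao2011_smooth_local_existence_forced` (Tao 2013, Thm. 5.4 (ii)+(iv)
WITH forcing). F2 is now the THEOREM `tao2011_smooth_local_existence_forced_holds`
(`Literature/Analysis/FluidPDE/TaoH1LocalExistenceForcedHolds.lean`: the tree's forced
Fourier–Picard engine). This file records the hypothesis-free rows (same binders minus `hF`, same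
conclusions), for a designed forced blow-up `D : DesignedBlowup ν` with `ν > 0`:

* `velocity_unbounded`, `exists_norm_gt`, `exists_norm_gt_near` — the `L^∞` criterion: `u` is
  unbounded on `[0, T) × ℝ³`, and the large values occur arbitrarily close to `T`;
* `not_exists_enstrophy_bound`, `exists_enstrophy_gt` — the `H¹` alternative: unbounded enstrophy;
* `enstrophy_rate` — Leray's `H¹` rate `min(1, cν³/(√(E + ∫|∇u(t)|²) + B + 1)⁴) ≤ T − t`;
* `lintegral_serrin_eq_top_normalised` / `…_taoPressure` — the Sohr corner
  `∫₀ᵀ ‖u‖_{L^r}^{2/(1−3/r)} = ∞`, `3 < r ≤ ∞`, for the Tao-normalised pressure resp. any Tao-class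
  pressure;
* `not_subTypeI_normalised` / `…_taoPressure` — no rate `‖u(t)‖_∞ ≤ C (T−t)^{−γ}`, `γ < 1/2`;
* `not_subLerayRate_normalised` / `…_taoPressure` — no rate `‖u(t)‖_{L^r} ≤ C (T−t)^{−γ}`,
  `γ < (1 − 3/r)/2`.

The only residual hypothesis anywhere is the pressure GAUGE in the three Serrin-scale rows.

References: T. Tao, Anal. PDE 6 (2013), Thm. 5.4 [cite: Tao2011, Thm. 5.4 (ii)+(iv)]; J. Leray,
Acta Math. 63 (1934), (3.16) [cite: Leray1934, (3.16)]; P. G. Lemarié-Rieusset (2016), Thm. 7.2,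
Thm. 11.2, Thm. 11.4 [cite: LemarieRieusset2016, Thm. 11.2]; H. Sohr (2001), Thm. V.1.8.1
[cite: Sohr2001, Thm. V.1.8.1]; J. T. Beale, T. Kato, A. Majda, Comm. Math. Phys. 94 (1984) §1
[cite: BealeKatoMajda1984, §1].
-/

noncomputable section

namespace Summit.NavierStokesRegularity.FluidComputer

namespace DesignedBlowup

open Set MeasureTheory Filter Topology Function
open scoped ENNReal NNReal
open Literature.Analysis.FluidPDE

variable {ν : ℝ} (D : DesignedBlowup ν)

/-! ## §1 The `L^∞` criterion -/

/-- **A designed forced blow-up is NOT bounded on `[0, T) × ℝ³`** (`ν > 0`; no named fact).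
[cite: LemarieRieusset2016, Thm. 11.2] [cite: BealeKatoMajda1984, §1] -/
theorem velocity_unbounded (hν : 0 < ν) : ¬ ∃ M : ℝ, ∀ t ∈ Ico 0 D.T, ∀ x, ‖D.u t x‖ ≤ M :=
  D.velocity_unbounded_of_F2 tao2011_smooth_local_existence_forced_holds hν

/-- **For every bound `M` some point of `[0, T) × ℝ³` beats it** (no named fact).
[cite: Leray1934, (3.16)] -/
theorem exists_norm_gt (hν : 0 < ν) (M : ℝ) : ∃ t ∈ Ico 0 D.T, ∃ x, M < ‖D.u t x‖ :=
  D.exists_norm_gt_of_F2 tao2011_smooth_local_existence_forced_holds hν M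

/-- **The sup norm blows up AT `T`**: for every `t₀ < T` and every `M` some `(t, x)` with
`t₀ < t < T` has `‖u(t, x)‖ > M` (no named fact). [cite: Leray1934, (3.16)]
[cite: BealeKatoMajda1984, §1] -/
theorem exists_norm_gt_near (hν : 0 < ν) {t₀ : ℝ} (ht₀ : t₀ < D.T) (M : ℝ) :
    ∃ t ∈ Ioo t₀ D.T, ∃ x, M < ‖D.u t x‖ :=
  D.exists_norm_gt_near_of_F2 tao2011_smooth_local_existence_forced_holds hν ht₀ M

/-! ## §2 The `H¹` alternative and Leray's `H¹` rate -/

/-- **The enstrophy of a designed forced blow-up is NOT bounded on `[0, T)`** (`ν > 0`; no named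
fact, no hypothesis on `∂ₜu` or on any pressure). [cite: LemarieRieusset2016, Thm. 7.2]
[cite: Tao2011, Thm. 5.4 (ii)+(iv)] -/
theorem not_exists_enstrophy_bound (hν : 0 < ν) :
    ¬ ∃ B : ℝ≥0, ∀ t ∈ Ico 0 D.T,
        ∫⁻ x, ENNReal.ofReal (frobeniusNormSq (fderiv ℝ (D.u t) x)) ≤ B :=
  D.not_enstrophy_bounded_of_F2 tao2011_smooth_local_existence_forced_holds hν

/-- **Unbounded enstrophy at the blow-up time**: for every `B` some slice `t < T` has
`∫|∇u(t)|² > B` (no named fact). [cite: LemarieRieusset2016, Thm. 7.2] -/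
theorem exists_enstrophy_gt (hν : 0 < ν) (B : ℝ≥0) :
    ∃ t ∈ Ico 0 D.T, (B : ℝ≥0∞) < ∫⁻ x, ENNReal.ofReal (frobeniusNormSq (fderiv ℝ (D.u t) x)) :=
  D.enstrophy_unbounded_of_F2 tao2011_smooth_local_existence_forced_holds hν B

/-- **LERAY'S `H¹` BLOW-UP RATE for every designed forced blow-up** (`ν > 0`; no named fact):
there are `c > 0`, `B ≥ 0` and a finite `E` with
`min(1, c ν³ / (√((E + ∫|∇u(t)|²).toReal) + B + 1)⁴) ≤ T − t` for every `t ∈ [0, T)` — the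
enstrophy blows up at least like `(T − t)^{−1/2}` up to the additive constants.
[cite: Leray1934, (3.16)] [cite: Tao2011, Thm. 5.4 (ii)+(iv)] -/
theorem enstrophy_rate (hν : 0 < ν) :
    ∃ c : ℝ, 0 < c ∧ ∃ B : ℝ, 0 ≤ B ∧ ∃ E : ℝ≥0∞, E < ⊤ ∧ ∀ t ∈ Ico 0 D.T,
      min 1 (c * ν ^ 3 /
        (Real.sqrt (E + ∫⁻ x, ENNReal.ofReal (frobeniusNormSq (fderiv ℝ (D.u t) x))).toReal + B + 1) ^ 4)
        ≤ D.T - t :=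
  D.enstrophy_rate_of_F2 tao2011_smooth_local_existence_forced_holds hν

/-! ## §3 The Serrin scale: Sohr corner, Type-II floor, no sub-Leray rate -/

/-- **The Sohr corner for a design with normalised pressure** (`p = −Δ⁻¹∂ᵢ∂ⱼ(uᵢuⱼ) + Δ⁻¹∇·f` on
`[0, T)`; `ν > 0`; no named fact): `∫₀ᵀ ‖u(t)‖_{L^r}^{2/(1−3/r)} dt = ∞` for every `3 < r ≤ ∞`.
[cite: LemarieRieusset2016, Thm. 11.2] [cite: Sohr2001, Thm. V.1.8.1] -/
theorem lintegral_serrin_eq_top_normalised (hν : 0 < ν)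
    (hnorm : HasForcedNormalisedPressure D.u D.f D.p (Ico 0 D.T)) {r : ℝ≥0∞} (hr : 3 < r) :
    ∫⁻ t in Ioo 0 D.T,
        ENNReal.ofReal ((eLpNorm (D.u t) r volume).toReal ^ (2 / (1 - (3 / r).toReal))) = ⊤ :=
  D.lintegral_serrin_eq_top_of_F2 tao2011_smooth_local_existence_forced_holds hν hnorm hr

/-- **The Sohr corner with an arbitrary Tao-class pressure `p'`** (`(u, p')` classical on `[0, T)`,
`∂ₜu` and `p'` with bounded `L²` Sobolev norms on closed sub-slabs; `ν > 0`; no named fact).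
[cite: LemarieRieusset2016, Thm. 11.2] [cite: Sohr2001, Thm. V.1.8.1] -/
theorem lintegral_serrin_eq_top_taoPressure (hν : 0 < ν)
    {p' : ℝ → EuclideanSpace ℝ (Fin 3) → ℝ}
    (hsol : IsClassicalNSSolutionOn (Ico 0 D.T) ν D.f D.u p')
    (hut : ∀ T' ∈ Ioo 0 D.T, HasBoundedSobolevNormsOn (Icc 0 T') (timeDerivWithin (Icc 0 T') D.u))
    (hp : ∀ T' ∈ Ioo 0 D.T, ∀ n : ℕ, ∃ C : ℝ≥0, ∀ t ∈ Icc 0 T',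
      ∫⁻ x, ‖iteratedFDeriv ℝ n (p' t) x‖ₑ ^ 2 ≤ C)
    {r : ℝ≥0∞} (hr : 3 < r) :
    ∫⁻ t in Ioo 0 D.T,
        ENNReal.ofReal ((eLpNorm (D.u t) r volume).toReal ^ (2 / (1 - (3 / r).toReal))) = ⊤ :=
  D.lintegral_serrin_eq_top_of_F2' tao2011_smooth_local_existence_forced_holds hν hsol hut hp hr

/-- **Not sub-Type-I, for a design with normalised pressure** (`ν > 0`; no named fact): no
`C ≥ 0`, `γ < 1/2` with `‖u(t)‖_{L^∞} ≤ C (T − t)^{−γ}` on `(0, T)`.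
[cite: LemarieRieusset2016, Thm. 11.2] [cite: Leray1934, (3.16)] -/
theorem not_subTypeI_normalised (hν : 0 < ν)
    (hnorm : HasForcedNormalisedPressure D.u D.f D.p (Ico 0 D.T))
    {C γ : ℝ} (hCγ : 0 ≤ C) (hγ : γ < 1 / 2)
    (hrate : ∀ t ∈ Ioo 0 D.T, eLpNorm (D.u t) ⊤ volume ≤ ENNReal.ofReal (C * (D.T - t) ^ (-γ))) :
    False :=
  D.not_subTypeI_of_F2 tao2011_smooth_local_existence_forced_holds hν hnorm hCγ hγ hrate

/-- **Not sub-Type-I with an arbitrary Tao-class pressure `p'`** (`ν > 0`; no named fact).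
[cite: LemarieRieusset2016, Thm. 11.2] [cite: Leray1934, (3.16)] -/
theorem not_subTypeI_taoPressure (hν : 0 < ν)
    {p' : ℝ → EuclideanSpace ℝ (Fin 3) → ℝ}
    (hsol : IsClassicalNSSolutionOn (Ico 0 D.T) ν D.f D.u p')
    (hut : ∀ T' ∈ Ioo 0 D.T, HasBoundedSobolevNormsOn (Icc 0 T') (timeDerivWithin (Icc 0 T') D.u))
    (hp : ∀ T' ∈ Ioo 0 D.T, ∀ n : ℕ, ∃ C : ℝ≥0, ∀ t ∈ Icc 0 T',
      ∫⁻ x, ‖iteratedFDeriv ℝ n (p' t) x‖ₑ ^ 2 ≤ C)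
    {C γ : ℝ} (hCγ : 0 ≤ C) (hγ : γ < 1 / 2)
    (hrate : ∀ t ∈ Ioo 0 D.T, eLpNorm (D.u t) ⊤ volume ≤ ENNReal.ofReal (C * (D.T - t) ^ (-γ))) :
    False :=
  D.not_subTypeI_of_F2' tao2011_smooth_local_existence_forced_holds hν hsol hut hp hCγ hγ hrate

/-- **No sub-Leray rate in `L^r` for a design with normalised pressure** (`ν > 0`, `3 < r ≤ ∞`,
`C ≥ 0`, `γ < (1 − (3/r).toReal)/2`; no named fact): the bound `‖u(t)‖_{L^r} ≤ C (T−t)^{−γ}` on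
`(0, T)` is impossible. [cite: Leray1934, (3.16)] [cite: LemarieRieusset2016, Thm. 11.4] -/
theorem not_subLerayRate_normalised (hν : 0 < ν)
    (hnorm : HasForcedNormalisedPressure D.u D.f D.p (Ico 0 D.T))
    {r : ℝ≥0∞} (hr : 3 < r) {C γ : ℝ} (hC : 0 ≤ C) (hγ : γ < (1 - (3 / r).toReal) / 2)
    (hrate : ∀ t ∈ Ioo 0 D.T, eLpNorm (D.u t) r volume ≤ ENNReal.ofReal (C * (D.T - t) ^ (-γ))) :
    False :=
  D.not_subLerayRate_of_F2 tao2011_smooth_local_existence_forced_holds hν hnorm hr hC hγ hrate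

/-- **No sub-Leray rate in `L^r` with an arbitrary Tao-class pressure `p'`** (`ν > 0`; no named
fact). [cite: Leray1934, (3.16)] [cite: LemarieRieusset2016, Thm. 11.4] -/
theorem not_subLerayRate_taoPressure (hν : 0 < ν)
    {p' : ℝ → EuclideanSpace ℝ (Fin 3) → ℝ}
    (hsol : IsClassicalNSSolutionOn (Ico 0 D.T) ν D.f D.u p')
    (hut : ∀ T' ∈ Ioo 0 D.T, HasBoundedSobolevNormsOn (Icc 0 T') (timeDerivWithin (Icc 0 T') D.u))
    (hp : ∀ T' ∈ Ioo 0 D.T, ∀ n : ℕ, ∃ C : ℝ≥0, ∀ t ∈ Icc 0 T',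
      ∫⁻ x, ‖iteratedFDeriv ℝ n (p' t) x‖ₑ ^ 2 ≤ C)
    {r : ℝ≥0∞} (hr : 3 < r) {C γ : ℝ} (hC : 0 ≤ C) (hγ : γ < (1 - (3 / r).toReal) / 2)
    (hrate : ∀ t ∈ Ioo 0 D.T, eLpNorm (D.u t) r volume ≤ ENNReal.ofReal (C * (D.T - t) ^ (-γ))) :
    False :=
  D.not_subLerayRate_of_F2' tao2011_smooth_local_existence_forced_holds hν hsol hut hp hr hC hγ hrate

end DesignedBlowup

end Summit.NavierStokesRegularity.FluidComputer

end
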